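import Summits.CriticalPhenomena.PercolationContinuityZ3.Theorems.Transplant.SkelSignClosureResidues
import Summits.CriticalPhenomena.PercolationContinuityZ3.Theorems.Transplant.SkelPhiStepIFacts
import Summits.CriticalPhenomena.PercolationContinuityZ3.Theorems.Transplant.PlanarSkeletonSign1
import HarnessLib

/-!
# D″ node, option S: the (Z″) ASSEMBLY TOPS FOR THE SINGLE-TYPE NODE `SamePDropOfSkeletonSign₁` (DPRIME-SCOPE addendum N.2) —
# `samePDropOfSkeletonSign₁_of_stepI_run_centred` (Step I′ discharged by `exists_stepI_single'` at the root's type, the instance handed the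
# seven facts AND the 8th fact `MonoAbove`/`TwoUnitL`, root in base position) and `samePDropOfSkeletonSign₁_of_concSG_residuesRH` (the p-free
# constants produced here; the instance returns two-unit cells, a schedule and the three residues) — the ₁-twins of p250015 / p250290

builds on p205010 (kernel theorem, internal audit signed; external expert review pending) — nothing in this file uses p205010.
Lane `prim-bschramm`, seat `prim-bschramm-p3` (gen 7; D″ design owner); helper file (`--supports stmt-CriticalPhenomena-4575`).
[cite: KozmaNitzan2024, §1 p. 2 (approach 1); §4 Theorem 6 (pp. 25–31), p. 15, p. 17 (Step I), (30), (32), Lemmas 10–12]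
[cite: Hutchcroft2016, Thm. 1] [cite: LyonsPeres2016, Thm. 7.6]
-/

noncomputable section

open MeasureTheory ProbabilityTheory
open scoped ENNReal Classical

namespace Summit.CriticalPhenomena.PercolationContinuityZ3.Theorems.Transplant

open Literature.Probability.Percolation Literature.Probability.LatticeModels SimpleGraph KNCells KNLevels
open Literature.Barriers.CriticalPhenomena (HasExponentialGrowth countable_of_connected_of_locallyFinite)
open BoxProdZ2 (ConcRadiiG)

namespace PlanarSkeletonSign

/-! ## §1 The top with Step I′ discharged (single type, centred, 8th fact handed) -/

/-- **THE ASSEMBLY TOP OF THE CLOSURE OF RECORD.**  Suppose that for every locally finite `G` NOT of exponential growth with a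
`PlanarSkeletonSign Φ` having ONE base vertex type `t` (`Φ.types = {t}`) in base position (`Φ.φ t = 0`), every `0 < p < 1` with a.s. uniqueness,
Φ2 (`hC`) and `θ_t(p) > 0`, the instance names `δI > 0` and `m₀`; receives Step-I′ data `D, off, M₀, n₁` with the seven facts, `MonoAbove D` and
`TwoUnitL D`; returns admissible finite lists `Sz Sx Sy` and, at every `q ∈ [p/2, p]` where the Step-I′ family over `StepI.index {t} Sz Sx Sy`
holds with accuracy `δI` under Φ2, a run-restricted anchored-cells scheme rooted at `t` at density `q` with `KitAtRun`.  Then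
`SamePDropOfSkeletonSign₁`. [cite: KozmaNitzan2024, §1 p. 2 (approach 1); §4 Theorem 6 (pp. 25–31), p. 17] -/
theorem samePDropOfSkeletonSign₁_of_stepI_run_centred
    (h : ∀ {V : Type} [DecidableEq V] [Countable V] (G : SimpleGraph V) [G.LocallyFinite] (Φ : PlanarSkeletonSign G),
      ¬ HasExponentialGrowth G → ∀ t ∈ Φ.types, Φ.types = {t} → Φ.φ t = 0 → ∀ p : unitInterval, 0 < (p : ℝ) → (p : ℝ) < 1 →
        (∀ᵐ ω ∂bondPercolation G p, numInfiniteClusters ω ≤ 1) → ∀ hC : Φ.CylSubcritical p, 0 < theta G t p →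
          ∃ (δI : ℝ) (m₀ : ℕ), 0 < δI ∧
            ∀ (D : Skelφ.StepI.Data V) (off M₀ n₁ : ℕ), m₀ ≤ D.k → 1 ≤ D.k → D.R = Skelφ.fatRadius Φ.frame hC →
              D.Λ = Skelφ.fatSeqOff Φ.frame hC off → D.k < M₀ → D.k < n₁ → (∀ ℓ, D.k ≤ D.Gb ℓ ∧ D.k ≤ D.Fb ℓ) →
              Skelφ.StepI.MonoAbove D → Skelφ.StepI.TwoUnitL D →
              ∃ Sz Sx Sy : Finset ℕ, (∀ M ∈ Sz, M₀ ≤ M) ∧ (∀ ℓ ∈ Sx, n₁ ≤ ℓ) ∧ (∀ ℓ ∈ Sy, n₁ ≤ ℓ) ∧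
                ∀ q : unitInterval, (p : ℝ) / 2 ≤ q → (q : ℝ) ≤ p →
                  (∀ i ∈ Skelφ.StepI.index {t} Sz Sx Sy,
                    1 - δI < (bondPercolation G q).real (Skelφ.StepI.event G Φ.φ D i)) →
                  Φ.CylSubcritical q →
                    ∃ (A : Type) (S : KSchA V A) (FD : FaceData V A) (LD : LevelData V A) (ε' δ₂ : ℝ),
                      S.Γ.root = t ∧ S.p = q ∧
                      RunGeom G S.Γ ∧ AnchGeom S.Γ ∧ SepGeom₂ G S.Γ ∧ ExitGeom G S.Γ ∧ StepsGeom S.Γ FD ∧ LevelGeom G S.Γ FD LD ∧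
                      S.δc ≤ 1 ∧ 0 ≤ ε' ∧ δ₂ ≤ 1 ∧ 4 * ((1 - δ₂) ^ S.Γ.K + ε') ≤ (1 / 2) ^ 32 ∧
                      KSchA.KitAtRun G S FD δ₂ ε') :
    SamePDropOfSkeletonSign₁ := by
  refine samePDropOfSkeletonSign₁_of_subexponential_case' fun {V} G _ Φ hg t ht h1 hC => ?_
  haveI : Countable V := countable_of_connected_of_locallyFinite G (Φ.toPlanarSkeletonNeg.graph_connected t) t
  -- pass to the re-centred skeleton (same base vertices, Φ2 transported)
  have hCΨ : (Φ.shift (Φ.φ t)).CylSubcritical (criticalProbIOf G t) :=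
    (Φ.shift_cylSubcritical_iff_skelφ (Φ.φ t) _).2 ((Φ.toPlanarSkeletonNeg.cylSubcritical_iff_skelφ _).1 hC)
  have htΨ : t ∈ (Φ.shift (Φ.φ t)).types := ht
  have h1Ψ : (Φ.shift (Φ.φ t)).types = {t} := h1
  refine theta_criticalProbIOf_eq_zero_of_drop_at G t fun hθ => ?_
  have hp0 : 0 < ((criticalProbIOf G t : unitInterval) : ℝ) := pos_of_theta_pos hθ
  have hp1 : ((criticalProbIOf G t : unitInterval) : ℝ) < 1 := Φ.criticalProb_lt_one t
  have hU := (Φ.shift (Φ.φ t)).numInfiniteClusters_le_one hg htΨ (criticalProbIOf G t)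
  obtain ⟨δI, m₀, hδI, hB⟩ := h G (Φ.shift (Φ.φ t)) hg t htΨ h1Ψ (sub_self _) _ hp0 hp1 hU hCΨ hθ
  -- Step I′ for the root's type on the centred skeleton at `p_c`, with the 8th fact
  obtain ⟨D, off, M₀, n₁, hk₀, hk₁, hR, hΛ, hM₀, hn₁, hGF, -, hmono, htwo, hfam⟩ :=
    (Φ.shift (Φ.φ t)).exists_stepI_single' hg hCΨ hθ htΨ hδI m₀ 0
  obtain ⟨Sz, Sx, Sy, hSz, hSx, hSy, hq⟩ := hB D off M₀ n₁ hk₀ hk₁ hR hΛ hM₀ hn₁ hGF hmono htwo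
  -- the structure-free pointwise drop with (A) := the Step-I′ family
  exact Skelφ.exists_drop_of_inputs_run' (φ := (Φ.shift (Φ.φ t)).φ) (types := (Φ.shift (Φ.φ t)).types) t hp0
    (((Φ.shift (Φ.φ t)).toPlanarSkeletonNeg.cylSubcritical_iff_skelφ _).1 hCΨ)
    (Skelφ.StepI.index {t} Sz Sx Sy) (Skelφ.StepI.event G (Φ.shift (Φ.φ t)).φ D)
    (Skelφ.StepI.edges G (Φ.shift (Φ.φ t)).φ D) (fun _ => 1 - δI)
    (fun i _ => Skelφ.StepI.determinedBy_event G (Φ.shift (Φ.φ t)).φ D i) (hfam Sz Sx Sy hSz hSx hSy)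
    fun q hq1 hq2 hcq hCq => hq q hq1 hq2 hcq (((Φ.shift (Φ.φ t)).toPlanarSkeletonNeg.cylSubcritical_iff_skelφ q).2 hCq)

/-! ## §2 The top from the three residues (constants produced here) -/

/-- **THE PARTIAL CLOSURE OF RECORD, run-restricted habitat form.**  Suppose that for all p-free constants `K₀ δ δ₂ δr` (with their bounds),
every locally finite `G` NOT of exponential growth with a one-type `PlanarSkeletonSign Φ` (`Φ.types = {t}`), `Φ.φ t = 0`, and every
`0 < p < 1` with Φ2 (`hC`), the instance names `δI > 0`, `m₀`, receives Step-I′ data with the seven facts, `MonoAbove` and `TwoUnitL`, and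
returns admissible finite lists `Sz Sx Sy` such that at every `q ∈ [p/2, p]` where the Step-I′ family holds with accuracy `δI` under Φ2 there are
two-unit cells `P : PCells2` and a schedule `Λ` with `Skelφ.WFS2 P Λ`, `K₀ ≤ P.K` and the three residues `Skel.RootOblT … δr`,
`Skelφ.FaceOblR … δ₂`, `Skel.ReachOblRH … δ` at the scheme `⟨Skelφ.cellGeomSG G Φ.φ P t Λ, q, δ⟩`.  Then `SamePDropOfSkeletonSign₁`.
[cite: KozmaNitzan2024, §4 Theorem 6 (pp. 25–31); §1 p. 2 (approach 1)] -/
theorem samePDropOfSkeletonSign₁_of_concSG_residuesRH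
    (hres : ∀ (K₀ : ℕ) (δ δ₂ : ℝ) (δr : ℕ → ℝ), 0 < δ → δ ≤ 1 → 0 < δ₂ → δ₂ ≤ 1 → (∀ n, 0 < δr n ∧ δr n ≤ 1) →
      ∀ {V : Type} [DecidableEq V] [Countable V] (G : SimpleGraph V) [G.LocallyFinite] (Φ : PlanarSkeletonSign G),
        ¬ HasExponentialGrowth G → ∀ t ∈ Φ.types, Φ.types = {t} → Φ.φ t = 0 → ∀ p : unitInterval, 0 < (p : ℝ) → (p : ℝ) < 1 →
          ∀ hC : Φ.CylSubcritical p,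
            ∃ (δI : ℝ) (m₀ : ℕ), 0 < δI ∧
              ∀ (D : Skelφ.StepI.Data V) (off M₀ n₁ : ℕ), m₀ ≤ D.k → 1 ≤ D.k → D.R = Skelφ.fatRadius Φ.frame hC →
                D.Λ = Skelφ.fatSeqOff Φ.frame hC off → D.k < M₀ → D.k < n₁ → (∀ ℓ, D.k ≤ D.Gb ℓ ∧ D.k ≤ D.Fb ℓ) →
                Skelφ.StepI.MonoAbove D → Skelφ.StepI.TwoUnitL D →
                ∃ Sz Sx Sy : Finset ℕ, (∀ M ∈ Sz, M₀ ≤ M) ∧ (∀ ℓ ∈ Sx, n₁ ≤ ℓ) ∧ (∀ ℓ ∈ Sy, n₁ ≤ ℓ) ∧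
                  ∀ q : unitInterval, (p : ℝ) / 2 ≤ q → (q : ℝ) ≤ p →
                    (∀ i ∈ Skelφ.StepI.index {t} Sz Sx Sy,
                      1 - δI < (bondPercolation G q).real (Skelφ.StepI.event G Φ.φ D i)) →
                    Φ.CylSubcritical q →
                      ∃ (P : PCells2) (Λ : ConcRadiiG), Skelφ.WFS2 P Λ ∧ K₀ ≤ P.K ∧
                        Skel.RootOblT G (⟨Skelφ.cellGeomSG G Φ.φ P t Λ, q, δ⟩ : KSchA V ℕ) Φ.Δ δr ∧
                        Skelφ.FaceOblR G Φ.φ (⟨Skelφ.cellGeomSG G Φ.φ P t Λ, q, δ⟩ : KSchA V ℕ) (Skelφ.faceDataSG G Φ.φ P t Λ) Φ.Δ δ₂ ∧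
                        Skel.ReachOblRH G (⟨Skelφ.cellGeomSG G Φ.φ P t Λ, q, δ⟩ : KSchA V ℕ) (Skelφ.faceDataSG G Φ.φ P t Λ) Φ.Δ δ) :
    SamePDropOfSkeletonSign₁ := by
  refine samePDropOfSkeletonSign₁_of_stepI_run_centred fun {V} _ _ G _ Φ hg t ht h1 h0 p hp0 hp1 hU hC hθ => ?_
  -- the p-free constants (`Φ.Δ` is the degree parameter; one chain accuracy for every corridor-chain length `≤ nmaxC`)
  have hε' : (0 : ℝ) < (1 / 2) ^ 35 := by positivity
  have hΔ : ∀ v, G.degree v ≤ Φ.Δ := Φ.degree_le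
  obtain ⟨δ, hδ0, hδ1, hchainH⟩ : ∃ δ : ℝ, 0 < δ ∧ δ ≤ 1 ∧ ∀ n ≤ Skel.nmaxC, ∀ (q : unitInterval), (q : ℝ) < 1 →
      ∀ (G' : SimpleGraph V) [G'.LocallyFinite], G' ≤ G →
        ∀ (Wt : Sym2 V → unitInterval) (s : Fin (n + 1) → TStep G') (T' : Fin (n + 1) → Finset V) (η : ℝ),
        (∀ i : Fin (n + 1), (s i).L.o = (s 0).L.o) →
        (∀ i : Fin n, T' (Fin.castSucc i) ⊆ (s i.succ).L.X 0) →
        (∀ i : Fin (n + 1), T' i ⊆ (s i).T) →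
        (∀ i : Fin (n + 1), (s i).KitsAt Wt q Φ.Δ δ) →
        η ≤ δ / 2 →
        (∀ i : Fin (n + 1), (prodBernoulli Wt).real (⋃ t ∈ (s i).T \ T' i, openConn (s 0).L.o t) ≤ η) →
        1 - δ < (prodBernoulli Wt).real (s 0).L.reachB →
          1 - (1 / 2 : ℝ) ^ 35 < (prodBernoulli Wt).real (⋃ t ∈ T' (Fin.last n), openConn (s 0).L.o t) :=
    ⟨Skelφ.δC G hΔ ((1 / 2) ^ 35), Skelφ.δC_pos G hΔ _, Skelφ.δC_le_one G hΔ _,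
      fun n hn q hq1 G' _ hG' => Skelφ.δC_spec G hΔ hε' hn hq1 G' hG'⟩
  obtain ⟨δ₂, hδ₂0, hδ₂1, hstep⟩ := SkelConc.apply_step_subgraph_UP G hΔ (half_pos hδ0)
  have hrc := fun n : ℕ => SkelConc.chain_edge_subgraph_UP G hΔ n hδ0
  choose δr hδr0 hδr1 hchainr using hrc
  obtain ⟨K₀, hK₀⟩ := exists_pow_lt_of_lt_one hε' (show 1 - δ₂ < 1 by linarith)
  -- the instance at `p`
  obtain ⟨δI, m₀, hδI, hS⟩ := hres K₀ δ δ₂ δr hδ0 hδ1 hδ₂0 hδ₂1 (fun n => ⟨hδr0 n, hδr1 n⟩) G Φ hg t ht h1 h0 p hp0 hp1 hC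
  refine ⟨δI, m₀, hδI, fun D off M₀ n₁ hk₀ hk₁ hR hΛ hM₀ hn₁ hGF hmono htwo => ?_⟩
  obtain ⟨Sz, Sx, Sy, hSz, hSx, hSy, hB⟩ := hS D off M₀ n₁ hk₀ hk₁ hR hΛ hM₀ hn₁ hGF hmono htwo
  refine ⟨Sz, Sx, Sy, hSz, hSx, hSy, fun q hq1 hq2 hcq hCq => ?_⟩
  -- (B) at `q`
  have hq1' : (q : ℝ) < 1 := lt_of_le_of_lt hq2 hp1
  obtain ⟨P, Λ, hWF, hK, hroot, hfaceO, hreachO⟩ := hB q hq1 hq2 hcq hCq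
  have hlip : Skelφ.Lip G Φ.φ := Φ.toPlanarSkeletonNeg.lip_skelφ
  have hsteps : Skelφ.Steps G Φ.φ := Φ.toPlanarSkeletonNeg.steps_skelφ
  refine ⟨ℕ, ⟨Skelφ.cellGeomSG G Φ.φ P t Λ, q, δ⟩, Skelφ.faceDataSG G Φ.φ P t Λ, Skelφ.levelDataS Φ.φ P, (1 / 2) ^ 35, δ₂, rfl, rfl,
    Skelφ.runGeomSG P t, Skelφ.anchGeomSG P t, Skelφ.sepGeom₂SG P t hWF h0 hsteps, Skelφ.exitGeomSG P t hWF hlip,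
    Skelφ.stepsGeomSG P t hWF hsteps, Skelφ.levelGeomSG P t hWF hlip, hδ1, hε'.le, hδ₂1, ?_, ?_⟩
  · -- `4((1-δ₂)^K + 2⁻³⁵) ≤ 2⁻³²` since `K ≥ K₀`
    have hKpow : (1 - δ₂) ^ P.K ≤ (1 / 2 : ℝ) ^ 35 :=
      (pow_le_pow_of_le_one (by linarith) (by linarith) hK).trans hK₀.le
    have h32 : (4 : ℝ) * ((1 / 2) ^ 35 + (1 / 2) ^ 35) = (1 / 2) ^ 32 := by norm_num
    show 4 * ((1 - δ₂) ^ P.K + (1 / 2 : ℝ) ^ 35) ≤ (1 / 2) ^ 32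
    linarith
  · exact Skelφ.kitAtRun_of_oblRH (S := ⟨Skelφ.cellGeomSG G Φ.φ P t Λ, q, δ⟩) hlip le_rfl
      (fun c Rπ => hstep q hq1' (Skel.winGraph G c Rπ) (Skel.winGraph_le G c Rπ))
      (fun n hn Ω => hchainH n hn q hq1' (Skel.winGraphIn G Ω) (Skel.winGraphIn_le G Ω))
      (fun n c Rπ => hchainr n q hq1' (Skel.winGraph G c Rπ) (Skel.winGraph_le G c Rπ)) hroot hfaceO hreachO

end PlanarSkeletonSign

end Summit.CriticalPhenomena.PercolationContinuityZ3.Theorems.Transplant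

end
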